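import Literature.AnabelianGeometry.AbsoluteAnabelian.AbsTopIII.CurveModelSchemaWitnesses
import Literature.AnabelianGeometry.AbsoluteAnabelian.MLFGaloisTypeProofs
import HarnessLib

/-!
# [AbsTopIII] Rmk. 1.9.2 relative to a model: INSTANCE FORMS of `CurveModel.Rmk_1_9_2` (FACT-LIST
# F-0236) at the NAMED toy interface `toyModel k 1` (LABELLED TOY CARRIER, `Δ = 1`)

S. Mochizuki, *Topics in Absolute Anabelian Geometry III: Global Reconstruction Algorithms*
[MochizukiAbsTopIII2015], §1, Rmk. 1.9.2 p. 38 (manuscript pagination, lit key `paper:url-5493eb38cbb7`):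
"When `k` is an MLF or NF, the 'extension of profinite groups `1 → Δ_X → Π_X → G_k → 1`' [...] may be
replaced by the single profinite group `Π_X` [cf. [AbsTopI] Thm. 2.6 (v), (vi)]".

PROOF-ONLY companion (cell abc-iut, block F, seat abc-iut-f-072 gen 13, KEY row «INST59G2»; no `def`,
no `instance`, no notation, no new named fact) of abc-iut-L4-t1's `CurveModel.lean` (imported via
`CurveModelSchemaWitnesses`, never edited).

CONTEXT.  `CurveModel.Rmk_1_9_2 M` is a NAMED FACT RELATIVE TO an interface `M : CurveModel`: every
isomorphism of the profinite groups `Π` between two curves of `M` whose base fields are both MLF's or both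
NF's carries `Δ` onto `Δ`.  Its universal closure is REFUTED in the tree (abc-iut-f-076
`CurveModel.not_forall_rmk_1_9_2`), the law-level closers of record are CONDITIONAL
(`rmk_1_9_2_of_geomTFG_of_coinvariantRankConstant`, `rmk_1_9_2_of_thm26v_of_geomIsMaxTFGNormalIn`,
abc-iut-f-076), and abc-iut-f-056's joint witness over `ℚ_p` (p433321/p434040) carries the row only as a
LATER conjunct, invisible to the kernel census.  This file records INSTANCE FORMS whose conclusion IS the
row's declaration applied to a NAMED interface of the tree:

* `CurveModel.rmk_1_9_2_toyModel_trivial k` — at abc-iut-f-076's `CurveModelSchemaWitness.toyModel k H`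
  with `H = 1` the TRIVIAL profinite group (one curve over `k`, `Π := G_k × 1 ↠ G_k`, so `Δ = {1} × 1 = 1`):
  every topological automorphism of `Π` maps `Δ = 1` onto `1`;
* `_rat` / `_padic`: at `k = ℚ` (an NF) and `k = ℚ_p` (an MLF, `isMLF_padic`) the hypothesis of the row
  FIRES at the pair `(X, X)` with the identity automorphism — displayed.

HONEST LABEL — DEGENERATE in `Δ` (`Δ = 1`): the automorphism `e` of `Π = G_k` is arbitrary but there is
nothing to preserve; with `H ≠ 1` the row FAILS at `toyModel k H` in general (abc-iut-f-076's refutation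
swaps the factors of `G_k × G_k`), and a non-degenerate instance (`Δ` characteristic in `Π`, e.g. via
`Z(G_k) = 1` or torsion-freeness of `G_k`, [AbsTopI] Thm. 2.6) is arithmetic content outside the tree.
Refereed pre-IUT material typed statements-first (D-0014); typed ≠ proved; an instance-form theorem about
OUR typed statement ≠ a theorem about [AbsTopIII] in print; nothing here bears on [IUTchIII] Cor. 3.12 or
takes a side; axioms standard.
-/

noncomputable section

open CategoryTheory

namespace Literature.AnabelianGeometry.AbsoluteAnabelian.AbsTopIII

open CurveModelSchemaWitness

/-- The geometric part `Δ = {1} × 1` of the toy extension `G_k × 1 ↠ G_k` (trivial second factor) is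
trivial. [cite: MochizukiAbsTopIII2015, Prop 1.4 p.31] -/
theorem CurveModelSchemaWitness.geom_toyExt_trivial (k : Type) [Field k] [CharZero k] :
    (toyExt k (ProfiniteGrp.ofFiniteGrp (FiniteGrp.of PUnit.{1}))).geom = ⊥ := by
  ext x
  rw [mem_geom_toyExt, Subgroup.mem_bot]
  constructor
  · intro h
    exact Prod.ext h rfl
  · intro h
    rw [h]
    rfl

/-- **F-0236 `CurveModel.Rmk_1_9_2` — INSTANCE FORM at the NAMED toy interface `toyModel k 1`** (one
curve over `k`, `Π := G_k × 1`, `Δ = 1`): every topological automorphism of `Π` carries `Δ = 1` onto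
`Δ = 1`, whatever the type (MLF / NF) of `k`.  HONEST LABEL: DEGENERATE in `Δ`.
[cite: MochizukiAbsTopIII2015, Rmk 1.9.2 p.38] -/
theorem CurveModel.rmk_1_9_2_toyModel_trivial (k : Type) [Field k] [CharZero k] :
    (toyModel k (ProfiniteGrp.ofFiniteGrp (FiniteGrp.of PUnit.{1}))).Rmk_1_9_2 := by
  intro X Y _ e
  show ((toyExt k _).geom).map e.toMonoidHom = (toyExt k _).geom
  rw [geom_toyExt_trivial, Subgroup.map_bot]

/-- **F-0236 at `k = ℚ` (an NF), hypothesis displayed FIRING**: the row holds at `toyModel ℚ 1` AND the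
interface has a pair of curves over NF base fields with an isomorphism of their `Π`'s (the identity) — the
NF branch of the row's hypothesis is met.  HONEST LABEL: DEGENERATE in `Δ`.
[cite: MochizukiAbsTopIII2015, Rmk 1.9.2 p.38] -/
theorem CurveModel.rmk_1_9_2_toyModel_trivial_rat :
    (toyModel ℚ (ProfiniteGrp.ofFiniteGrp (FiniteGrp.of PUnit.{1}))).Rmk_1_9_2 ∧
      ∃ X Y : (toyModel ℚ (ProfiniteGrp.ofFiniteGrp (FiniteGrp.of PUnit.{1}))).Curve,
        IsNF ((toyModel ℚ (ProfiniteGrp.ofFiniteGrp (FiniteGrp.of PUnit.{1}))).base X) ∧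
        IsNF ((toyModel ℚ (ProfiniteGrp.ofFiniteGrp (FiniteGrp.of PUnit.{1}))).base Y) ∧
        Nonempty (((toyModel ℚ (ProfiniteGrp.ofFiniteGrp (FiniteGrp.of PUnit.{1}))).ext X).arith ≃ₜ*
          ((toyModel ℚ (ProfiniteGrp.ofFiniteGrp (FiniteGrp.of PUnit.{1}))).ext Y).arith) :=
  ⟨CurveModel.rmk_1_9_2_toyModel_trivial ℚ, PUnit.unit, PUnit.unit, ⟨inferInstance⟩, ⟨inferInstance⟩,
    ⟨ContinuousMulEquiv.refl _⟩⟩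

/-- **F-0236 at `k = ℚ_p` (an MLF, `isMLF_padic`), hypothesis displayed FIRING**: the row holds at
`toyModel ℚ_p 1` AND the MLF branch of its hypothesis is met at the pair `(X, X)` with the identity
automorphism.  HONEST LABEL: DEGENERATE in `Δ`. [cite: MochizukiAbsTopIII2015, Rmk 1.9.2 p.38] -/
theorem CurveModel.rmk_1_9_2_toyModel_trivial_padic (p : ℕ) [Fact p.Prime] :
    (toyModel ℚ_[p] (ProfiniteGrp.ofFiniteGrp (FiniteGrp.of PUnit.{1}))).Rmk_1_9_2 ∧
      ∃ X Y : (toyModel ℚ_[p] (ProfiniteGrp.ofFiniteGrp (FiniteGrp.of PUnit.{1}))).Curve,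
        IsMLF ((toyModel ℚ_[p] (ProfiniteGrp.ofFiniteGrp (FiniteGrp.of PUnit.{1}))).base X) ∧
        IsMLF ((toyModel ℚ_[p] (ProfiniteGrp.ofFiniteGrp (FiniteGrp.of PUnit.{1}))).base Y) ∧
        Nonempty (((toyModel ℚ_[p] (ProfiniteGrp.ofFiniteGrp (FiniteGrp.of PUnit.{1}))).ext X).arith ≃ₜ*
          ((toyModel ℚ_[p] (ProfiniteGrp.ofFiniteGrp (FiniteGrp.of PUnit.{1}))).ext Y).arith) :=
  ⟨CurveModel.rmk_1_9_2_toyModel_trivial ℚ_[p], PUnit.unit, PUnit.unit, isMLF_padic p, isMLF_padic p,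
    ⟨ContinuousMulEquiv.refl _⟩⟩

end Literature.AnabelianGeometry.AbsoluteAnabelian.AbsTopIII
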